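import Literature.NumberTheory.LFunctions.Zhang2022.KnifeEdgeOverhangRankOne
import Literature.NumberTheory.LFunctions.Zhang2022.KnifeEdgeDiscMeanFlat
import Literature.NumberTheory.LFunctions.Zhang2022.SkeletonAssembly

/-!
# Zhang (2022), rung F-S3 (Landau–Siegel programme, family B-len): the long-mollifier estimate
# `E*-len(δ)` typed over the skeleton, and its POSITIVITY endgame proved

Y. Zhang, *Discrete mean estimates and the Landau–Siegel zero*, arXiv:2211.02515v1 [Zhang2022LandauSiegel] —
an unrefereed manuscript under adjudication. **WHAT THIS IS NOT: not a claim about Theorems 1–2 of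
arXiv:2211.02515, about Landau–Siegel zeros, or about Parity. The programme SEARCHES and TYPES; nothing here
asserts any estimate: `EStarLen`, `EStarLenCloses` are bare `Prop`s (registry row E-001 of the cell's
`obj/EDREGISTRY.md`), and every `theorem` is an implication between them and the
named nodes of `SkeletonPropositions`.**

**The objects (Part 1).** The discrete mean of the manuscript's §2 ((2.16)–(2.20), (8.3)–(8.4)) for an ARBITRARY
family of values `F(ψ,ρ)`: `discMean c' χ F = Σ_{(ψ,ρ) ∈ idx χ} Re 𝔠*(ρ,ψ)·‖F(ψ,ρ)‖²·Re ω(ρ)` (so that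
`Skeleton.xi11 = discMean (H₁)`, `Skeleton.xiJ = discMean (J₁)` by `rfl`), its absolute-weight twin
`discMeanAbs`, the total weight `discWeight`, and the profile polynomial of logarithmic length `log N/log P`,
`profPoly χ x g N s = Σ_{1≤n<N} ψχ(n)·g(log n/log P)·n^{−s}` — the four bookkeeping `def`s of the F-S2 transfer
card (`pub/zhang-knife/zhang-knife-transfer/Sketch.lean`, bodies verbatim), which `KnifeEdgeDiscMeanFlat.discMeanFlat`
wrote out inline; `discMean_profPoly_flat` is that theorem restated over them.

**The estimate (Part 2) = registry row E-001, alias E*-len(δ)** (LEVERS.md v1.1a §2 l.203–204, sketch `EStarLen`;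
FEASIBILITY.md v1.0b §0.5 «Lever A»): under (A), for one-sided profiles `g` of logarithmic length `1+δ`
(`Repair.OneSidedProfile`), the discrete mean of the profile polynomial of length `⌈P^{1+δ}⌉` has main term
`Re(𝔅_{1+δ}(g) + O(g,g))·𝔞𝔓` with `𝔅_{1+δ} = Repair.topDiagForm (1+δ)` (formula I continued past the wall (7.2),
`RepairTopFormIndefinite`) and a NAMED off-diagonal pair functional `O : KnifeEdge.PairFunctional` (the classes
`n ≡ m (mod p)`, `n ≠ m`; the object OPEN IN PRINT — nearest: `buiPrattRoblesZaharescu2020_theorem11/12`, one prime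
modulus, degree 2, `κ < 1/2 + 1/202`; the continued calculus is `O = 0`, asserted by no one beyond `δ = 0`). Typed in
the `ForAllLarge … AssumptionA D χ → |mean − main·𝔞𝔓| ≤ ε𝔞𝔓` shape of `Skeleton.Eval823`. The DECISION statement
`EStarLenCloses δ O`: some one-sided profile has `Re(𝔅_{1+δ}(g) + O(g,g)) < 0` (pure tree vocabulary).

**The endgame (Part 3), PROVED — this is the family's «POS» currency of the cell's OBJECTIVE.md §2.1 as a kernel
implication:** `theorem1_of_eStarLen : EStarLen c' δ O → EStarLenCloses δ O → Prop22i → Lemma23 c' → Theorem1`.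
Mechanism (LEVERS §0.6 (B1)): with Lemma 2.3 (`𝔠* ≥ 0`) and Prop. 2.2 (i) (sampled zeros on the line ⇒ `ω(ρ) > 0`,
`SkeletonAssembly.omegaW_re_pos`) every discrete mean is `≥ 0` (`discMean_nonneg`); a NEGATIVE main term of size
`𝔞𝔓` (`𝔞 ≫ 1`: `frakALowerBound_holds`; `𝔓 > 0`: `frakP_eventually_pos`) therefore contradicts (A) for all large
`D` (`eventually_not_assumptionA_of_negative_mainTerm`) — no Cauchy–Schwarz, no §18 margin. Also proved: the
continued calculus closes at EVERY `δ > 0` (`eStarLenCloses_zero`, = `Repair.topForm_indefinite`: the knife edge,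
not news), Zhang's own piece closes at `δ = 1/20` whenever `Re O(ϰ_{21/20,5/2}) < 0.04311`
(`eStarLenCloses_of_kappa`, = `Repair.lengthKnifeEdge_witness`; `oneSidedProfile_kappaP`: the piece is a one-sided
profile at every length), the general sufficient instance `eStarLenCloses_of_re_lt_one`, and the converse
bookkeeping `not_eStarLenCloses_of_nonneg` (an `O` completing a PSD form never closes — the (B1) prediction B-AH).

**Deliberately NOT here:** row E-002 / definition request D-len-1 (`OffDiagForm`: the axioms a derivation of `O`
would deliver) — a separate file once the family's EDLIST fixes them; rows E-004/E-005/E-006 (band width, band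
variance, bulk × band cross term: predicates over the Part-1 vocabulary) — the companion typer's file; any claim that `EStarLen` or `EStarLenCloses` holds for the true `O`.
References: Zhang, arXiv:2211.02515v1, §2 (2.14)–(2.20), (2.31)–(2.33), Lemma 2.3, Prop. 2.2; §7 Prop 7.1, (7.2);
§8 (8.3), (8.23) [cite: Zhang2022LandauSiegel, §2, §7 Prop 7.1 (7.2), §8 (8.23)]; the nearest printed technology
H. M. Bui, K. Pratt, N. Robles, A. Zaharescu (2020) [BuiPrattRoblesZaharescu2020].
-/

noncomputable section

open Complex Real ComplexConjugate Set
open _root_.MeasureTheory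

namespace Literature.NumberTheory.LFunctions.Zhang2022

namespace KnifeEdge

open Repair Skeleton

/-! ### Part 1 — the discrete mean of a profile polynomial (bookkeeping `def`s of the F-S2 transfer card) -/

/-- The profile polynomial `Σ_{1≤n<N} χψ(n)·g(log n/log P)·n^{−s}` of length `N` for the member `x = (p, ψ)` of
Zhang's family (`Skeleton.pc χ x n = ψ(n)χ(n)`; the twist `(P_j/n)^{β}` of (2.23)–(2.25) is carried by the complex
profile `g`, as in `Repair.kappaP`). [cite: Zhang2022LandauSiegel, §2 (2.23)–(2.25), §7 (7.2)] -/
def profPoly {D : ℕ} (χ : DirichletCharacter ℂ D) (x : Chr D) (g : ℝ → ℂ) (N : ℕ) (s : ℂ) : ℂ :=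
  ∑ n ∈ Finset.Ico 1 N, pc χ x n * g (Real.log n / Real.log (bigP D)) * (n : ℂ) ^ (-s)

variable (c' : ℝ) {D : ℕ} (χ : DirichletCharacter ℂ D)

/-- **Zhang's discrete mean** `Σ_{ψ∈Ψ₁} Σ_{ρ∈𝔷(ψ)} Re 𝔠*(ρ,ψ)·‖F(ψ,ρ)‖²·Re ω(ρ)` of a family of values `F`,
over the index set `Skeleton.idx χ` (the shape of (8.3) `Ξ₁₁`, (2.33) `Ξ_J`: `xi11_eq_discMean`, `xiJ_eq_discMean`).
[cite: Zhang2022LandauSiegel, §2 (2.16)–(2.20), §8 (8.3)] -/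
def discMean (F : Chr D → ℂ → ℂ) : ℝ :=
  ∑ i ∈ idx χ, (cstar c' D i.1 i.2).re * ‖F i.1 i.2‖ ^ 2 * (omegaW D i.2).re

/-- The same sum with absolute weights `|Re 𝔠*·Re ω|` (`= discMean` when the weights are `≥ 0`,
`discMean_eq_discMeanAbs`). [cite: Zhang2022LandauSiegel, §2 (2.16)–(2.20)] -/
def discMeanAbs (F : Chr D → ℂ → ℂ) : ℝ :=
  ∑ i ∈ idx χ, |(cstar c' D i.1 i.2).re * (omegaW D i.2).re| * ‖F i.1 i.2‖ ^ 2

/-- The total absolute weight `Σ_{(ψ,ρ)} |Re 𝔠*(ρ,ψ)·Re ω(ρ)|` (the trivial-bound scale of a discrete mean).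
[cite: Zhang2022LandauSiegel, §2 (2.16)–(2.20)] -/
def discWeight : ℝ := ∑ i ∈ idx χ, |(cstar c' D i.1 i.2).re * (omegaW D i.2).re|

/-- `Ξ₁₁ = ΣΣ 𝔠*|H₁|²ω` (8.3) IS the discrete mean of `H₁`. [cite: Zhang2022LandauSiegel, §8 (8.3)] -/
theorem xi11_eq_discMean : xi11 c' χ = discMean c' χ (H1 χ) := rfl

/-- `Ξ_J = ΣΣ 𝔠*|J₁|²ω` (2.33) IS the discrete mean of `J₁`. [cite: Zhang2022LandauSiegel, §2 (2.33)] -/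
theorem xiJ_eq_discMean : xiJ c' χ = discMean c' χ (J1 χ) := rfl

variable {c' χ}

/-- A discrete mean with non-negative weights `Re 𝔠*(ρ,ψ)·Re ω(ρ) ≥ 0` is `≥ 0` — the positivity (B1) of
LEVERS §0.6 at a fixed modulus. [cite: Zhang2022LandauSiegel, §2 Lemma 2.3, (2.15)] -/
theorem discMean_nonneg (hw : ∀ i ∈ idx χ, 0 ≤ (cstar c' D i.1 i.2).re * (omegaW D i.2).re)
    (F : Chr D → ℂ → ℂ) : 0 ≤ discMean c' χ F := by
  unfold discMean
  refine Finset.sum_nonneg fun i hi => ?_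
  have := mul_nonneg (hw i hi) (sq_nonneg ‖F i.1 i.2‖)
  nlinarith

/-- With non-negative weights the absolute-weight twin is the discrete mean itself.
[cite: Zhang2022LandauSiegel, §2 Lemma 2.3, (2.15)] -/
theorem discMean_eq_discMeanAbs (hw : ∀ i ∈ idx χ, 0 ≤ (cstar c' D i.1 i.2).re * (omegaW D i.2).re)
    (F : Chr D → ℂ → ℂ) : discMean c' χ F = discMeanAbs c' χ F := by
  unfold discMean discMeanAbs
  refine Finset.sum_congr rfl fun i hi => ?_
  rw [abs_of_nonneg (hw i hi)]
  ring

/-- The total weight is `≥ 0`. [cite: Zhang2022LandauSiegel, §2 (2.16)] -/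
theorem discWeight_nonneg : 0 ≤ discWeight c' χ :=
  Finset.sum_nonneg fun _ _ => abs_nonneg _

/-- **Lemma 2.3 + Prop. 2.2 (i) give non-negative weights** at every index of the double sum, for `D ≥ 3`
(`𝔠* ≥ 0` on `Ψ₁ × 𝔷(ψ)`; zeros of `L(s,ψ)L(s,ψχ)` in `Ω` on the line ⇒ `ω(ρ) > 0`, `SkeletonAssembly.omegaW_re_pos`).
[cite: Zhang2022LandauSiegel, §2 Lemma 2.3, Prop. 2.2 (i), (2.15)] -/
theorem weights_nonneg_of [NeZero D] (hD : 3 ≤ D)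
    (h23 : ∀ x ∈ PsiOne χ, ∀ ρ ∈ zeroSet D x, (cstar c' D x ρ).im = 0 ∧ 0 ≤ (cstar c' D x ρ).re)
    (h22 : ∀ x ∈ PsiOne χ, ∀ s ∈ prodZeroSetOmega χ x, s.re = 1 / 2) :
    ∀ i ∈ idx χ, 0 ≤ (cstar c' D i.1 i.2).re * (omegaW D i.2).re := by
  intro i hi
  rw [idx, Finset.mem_sigma] at hi
  have h1 : i.1 ∈ PsiOne χ := mem_of_mem_finsetOf hi.1
  have h2 : i.2 ∈ zeroSet D i.1 := mem_of_mem_finsetOf hi.2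
  have hre : i.2.re = 1 / 2 := h22 i.1 h1 i.2 (mem_prodZeroSetOmega_of_mem_zeroSet χ h2)
  exact mul_nonneg (h23 i.1 h1 i.2 h2).2 (omegaW_re_pos hD hre).1.le

/-- **Length-flatness over the Part-1 vocabulary** (`KnifeEdgeDiscMeanFlat.discMeanFlat`, which writes these
`def`s out): for `0 < ε < δ`, all large `D`, IF every sampled zero has `Re ρ = ½`, the discrete means of the profile
polynomials of a 1-Lipschitz `g`, `‖g‖ ≤ 1`, of lengths `⌈P^{1+δ}⌉` and `⌈P^{1+ε}⌉` differ by
`≤ P^{−ε/8}·(discMeanAbs(short) + discWeight)` — registry row E-003 (E*-inv) in this file's language.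
[cite: Zhang2022LandauSiegel, §2 (2.16)–(2.20); §8 Lemma 8.1] -/
theorem discMean_profPoly_flat (c' : ℝ) {δ ε : ℝ} (hε : 0 < ε) (hεδ : ε < δ) :
    ForAllLarge fun D _ χ =>
      (∀ i ∈ idx χ, (i.2).re = 1 / 2) →
        ∀ g : ℝ → ℂ, LipschitzWith 1 g → (∀ z, ‖g z‖ ≤ 1) →
          |discMean c' χ (fun x s => profPoly χ x g ⌈bigP D ^ (1 + δ)⌉₊ s) -
              discMean c' χ (fun x s => profPoly χ x g ⌈bigP D ^ (1 + ε)⌉₊ s)| ≤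
            bigP D ^ (-(ε / 8)) *
              (discMeanAbs c' χ (fun x s => profPoly χ x g ⌈bigP D ^ (1 + ε)⌉₊ s) + discWeight c' χ) :=
  KnifeEdgeDiscMeanFlat.discMeanFlat c' hε hεδ

/-! ### Part 2 — registry row E-001: `E*-len(δ)` and its decision statement (bare `Prop`s, none asserted) -/

/-- **E*-len(δ) — the long-mollifier asymptotic with a NAMED off-diagonal main term** (registry row E-001; LEVERS
§2 sketch `EStarLen`; status OPEN IN PRINT, price XL): `δ > 0`, and under (A), for every one-sided profile `g` of
logarithmic length `1 + δ` with marked right derivative `g′` (`Repair.OneSidedProfile`), the discrete mean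
`Σ_{ψ∈Ψ₁}Σ_{ρ∈𝔷(ψ)} 𝔠*(ρ,ψ)|H_g(ρ,ψ)|²ω(ρ)` of `H_g(s,ψ) = Σ_{n<⌈P^{1+δ}⌉} χψ(n)g(log n/log P)n^{−s}` equals
`Re(𝔅_{1+δ}(g) + O(g,g))·𝔞𝔓 + o(𝔞𝔓)`, where `𝔅_{1+δ} = Repair.topDiagForm (1+δ)` is formula I continued past
the wall (7.2) and `O` is the off-diagonal pair functional of the classes `n ≡ m (mod p)`, `n ≠ m` (the parameter;
`O = 0` is the continued diagonal calculus, a main term for NO length beyond `P` in print). Shape of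
`Skeleton.Eval823` («`Ξ₁₁ = 𝔠₁𝔞𝔓 + o(𝔓)`», the in-class dictionary this row extends), with the weaker error
`ε𝔞𝔓` of the sketch's normalised form. Nearest print: `buiPrattRoblesZaharescu2020_theorem11/12` (one prime
modulus, degree 2). TODO(class): a derivation may deliver the asymptotic only for a regularity class of profiles
(kinked / piecewise-`C¹`); the sketch's quantifier over all one-sided profiles is kept verbatim.
[cite: Zhang2022LandauSiegel, §7 Prop 7.1 (7.2), §8 (8.23)] -/
def EStarLen (c' δ : ℝ) (O : PairFunctional) : Prop :=
  0 < δ ∧ ∀ g g' : ℝ → ℂ, OneSidedProfile (1 + δ) g g' →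
    ∀ ε : ℝ, 0 < ε → ForAllLarge fun D _ χ => AssumptionA D χ →
      |discMean c' χ (fun x s => profPoly χ x g ⌈bigP D ^ (1 + δ)⌉₊ s)
          - (topDiagForm (1 + δ) g g' + O g g' g g').re * frakA χ * frakP D| ≤ ε * frakA χ * frakP D

/-- **E*-len(δ) CLOSES — the decision statement** (LEVERS §2 sketch `EStarLenCloses`, verbatim): some one-sided
profile of length `1 + δ` has NEGATIVE completed main term `Re(𝔅_{1+δ}(g) + O(g,g)) < 0`. For `O = 0` this holds at
every `δ > 0` (`eStarLenCloses_zero` = `Repair.topForm_indefinite`: the knife edge); for the honest (A)-world `O`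
the (B1) prediction B-AH is `¬ EStarLenCloses δ O` (`not_eStarLenCloses_of_nonneg` is that bookkeeping). Together
with `EStarLen` it is a `¬(A)` statement by positivity alone: `theorem1_of_eStarLen`.
[cite: Zhang2022LandauSiegel, §7 Prop 7.1 (7.2)] -/
def EStarLenCloses (δ : ℝ) (O : PairFunctional) : Prop :=
  ∃ g g' : ℝ → ℂ, OneSidedProfile (1 + δ) g g' ∧ (topDiagForm (1 + δ) g g' + O g g' g g').re < 0

/-! ### Part 3 — PROVED: the positivity endgame and the sufficient / obstructing instances -/

section Endgame

/-- **THE POSITIVITY ENDGAME at a fixed profile.** If under (A) the discrete mean of SOME profile polynomial has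
main term `m·𝔞𝔓 + o(𝔞𝔓)` with `m < 0`, then — given Prop. 2.2 (i) and Lemma 2.3, which make every discrete mean
`≥ 0` — (A) fails for every real primitive character to every large modulus. No Cauchy–Schwarz, no §18 margin:
`𝔞 ≥ a₀ > 0` (`frakALowerBound_holds`) and `𝔓 > 0` (`frakP_eventually_pos`) make `(m + ε)𝔞𝔓 < 0` at `ε = −m/2`.
[cite: Zhang2022LandauSiegel, §2 p. 6, Lemma 2.3, Prop. 2.2 (i), (2.15)] -/
theorem eventually_not_assumptionA_of_negative_mainTerm {c' m : ℝ} (hm : m < 0) {T : ℝ} {g : ℝ → ℂ}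
    (hasymp : ∀ ε : ℝ, 0 < ε → ForAllLarge fun D _ χ => AssumptionA D χ →
      |discMean c' χ (fun x s => profPoly χ x g ⌈bigP D ^ T⌉₊ s) - m * frakA χ * frakP D|
        ≤ ε * frakA χ * frakP D)
    (h22 : Prop22i) (h23 : Lemma23 c') :
    ∃ D₀ : ℕ, ∀ (D : ℕ) [NeZero D] (χ : DirichletCharacter ℂ D),
      D₀ ≤ D → χ.IsQuadratic → χ.IsPrimitive → ¬ AssumptionA D χ := by
  have hε : 0 < -m / 2 := by linarith
  obtain ⟨D₁, h₁⟩ := ((hasymp (-m / 2) hε).and h22).and h23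
  obtain ⟨a₀, ha₀, D₂, h₂⟩ := frakALowerBound_holds
  obtain ⟨D₃, h₃⟩ := frakP_eventually_pos
  refine ⟨max (max D₁ D₂) (max D₃ 3), fun D _ χ hD hq hp hA => ?_⟩
  have hD₁ : D₁ ≤ D := le_trans (le_trans (le_max_left _ _) (le_max_left _ _)) hD
  have hD₂ : D₂ ≤ D := le_trans (le_trans (le_max_right _ _) (le_max_left _ _)) hD
  have hD₃ : D₃ ≤ D := le_trans (le_trans (le_max_left _ _) (le_max_right _ _)) hD
  have hD3 : 3 ≤ D := le_trans (le_trans (le_max_right _ _) (le_max_right _ _)) hD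
  obtain ⟨⟨hmean, h22'⟩, h23'⟩ := h₁ D χ hD₁ hq hp
  have hmean' := hmean hA
  have hA0 : 0 < frakA χ := lt_of_lt_of_le ha₀ (h₂ D χ hD₂ hq hp hA)
  have hP0 : 0 < frakP D := h₃ D hD₃
  have hw := weights_nonneg_of hD3 h23' h22'
  have hpos := discMean_nonneg hw (fun x s => profPoly χ x g ⌈bigP D ^ T⌉₊ s)
  have hX : 0 < frakA χ * frakP D := mul_pos hA0 hP0
  have hup := (abs_le.mp hmean').2
  nlinarith

variable {c' δ : ℝ} {O : PairFunctional}

/-- **B-len's POS endgame as a kernel implication: `E*-len(δ)` + its closing + Zhang's Part-1 zero model ⇒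
Theorem 1 of the manuscript** (`L(1,χ) > c₁(log D)⁻²⁰²²`), via `SkeletonSetting.theorem1_of_eventually_not_assumptionA`.
The two `E*` hypotheses are OPEN (registry E-001, XL; prediction B-AH: the closing fails for the true `O`);
`Prop22i`, `Lemma23 c'` are CLAIMS of the manuscript's §§3–4 — nothing is asserted.
[cite: Zhang2022LandauSiegel, §2 p. 6, §7 Prop 7.1 (7.2)] -/
theorem theorem1_of_eStarLen (hE : EStarLen c' δ O) (hC : EStarLenCloses δ O) (h22 : Prop22i)
    (h23 : Lemma23 c') : Theorem1 := by
  obtain ⟨g, g', hg, hneg⟩ := hC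
  exact Skeleton.theorem1_of_eventually_not_assumptionA
    (eventually_not_assumptionA_of_negative_mainTerm hneg (hE.2 g g' hg) h22 h23)

/-- … and Theorem 2 (`L(σ,χ) ≠ 0` for `σ > 1 − c₂(log D)⁻²⁰²⁴`). [cite: Zhang2022LandauSiegel, §1 Theorem 2] -/
theorem theorem2_of_eStarLen (hE : EStarLen c' δ O) (hC : EStarLenCloses δ O) (h22 : Prop22i)
    (h23 : Lemma23 c') : Theorem2 :=
  Skeleton.theorem2_of_theorem1 (theorem1_of_eStarLen hE hC h22 h23)

/-- **Sufficient instance (general):** if `Re O(g,g) < 1` on every one-sided profile of length `1+δ` whose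
continued diagonal form is `−1`, then E*-len(δ) closes — `Repair.topForm_indefinite` supplies such a profile at
every `δ > 0`. [cite: Zhang2022LandauSiegel, §7 Prop 7.1 (7.2)] -/
theorem eStarLenCloses_of_re_lt_one (hδ : 0 < δ)
    (h : ∀ g g' : ℝ → ℂ, OneSidedProfile (1 + δ) g g' → (topDiagForm (1 + δ) g g').re = -1 →
      (O g g' g g').re < 1) : EStarLenCloses δ O := by
  obtain ⟨g, g', hg, hm1⟩ := topForm_indefinite (θ := 1 + δ) (by linarith)
  refine ⟨g, g', hg, ?_⟩
  rw [Complex.add_re, hm1]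
  have := h g g' hg hm1
  linarith

/-- **The knife edge in this language:** the continued calculus (`O = 0`) closes at EVERY `δ > 0` — which is why
a length design is informative only through its `O ≠ 0` row (cell OBJECTIVE.md §2.2, row len).
[cite: Zhang2022LandauSiegel, §7 Prop 7.1 (7.2)] -/
theorem eStarLenCloses_zero (hδ : 0 < δ) : EStarLenCloses δ 0 :=
  eStarLenCloses_of_re_lt_one hδ fun _ _ _ _ => by simp

/-- **Obstruction bookkeeping (the B-AH side):** an `O` whose completed form is `≥ 0` on one-sided profiles of
length `1+δ` never closes. [cite: Zhang2022LandauSiegel, §7 Prop 7.1 (7.2)] -/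
theorem not_eStarLenCloses_of_nonneg
    (h : ∀ g g' : ℝ → ℂ, OneSidedProfile (1 + δ) g g' → 0 ≤ (topDiagForm (1 + δ) g g' + O g g' g g').re) :
    ¬ EStarLenCloses δ O := by
  rintro ⟨g, g', hg, hneg⟩
  exact not_lt.2 (h g g' hg) hneg

end Endgame

/-! ### Part 3b — Zhang's own piece `ϰ_{ν,k}` is a one-sided profile at EVERY length; the `δ = 1/20` instance -/

section Kappa

variable {ν k : ℝ}

/-- **`ϰ_{ν,k}` is a one-sided profile of length `ν`, for every `ν > 0`** (continuous on `[0,ν]`, right derivative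
`ϰ′` on `(0,ν)`, `ϰ(ν) = 0`); for `ν ≤ 1` this is contained in `Repair.kinkedProfile_kappaP`, for `ν > 1` it makes
the exhibit `Repair.lengthKnifeEdge_witness` a profile of `EStarLenCloses`. [cite: Zhang2022LandauSiegel, (2.23)–(2.25)] -/
theorem oneSidedProfile_kappaP (hν : 0 < ν) : OneSidedProfile ν (kappaP ν k) (kappaP' ν k) where
  cont := by
    have hform : Continuous fun y : ℝ =>
        (((1 - y / ν : ℝ)) : ℂ) * cexp ((k : ℂ) * π * I * ((ν - y : ℝ) : ℂ)) := by fun_prop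
    refine (hform.continuousOn.congr fun y hy => ?_)
    exact kappaP_of_le hy.2
  hasDeriv := by
    intro x hx
    have hxν : x < ν := hx.2
    -- derivative of the formula at `x`
    have h1 : HasDerivAt (fun y : ℝ => (((1 - y / ν : ℝ)) : ℂ)) (((-(1 / ν) : ℝ) : ℂ)) x := by
      have := ((hasDerivAt_id x).div_const ν).const_sub (1 : ℝ)
      have e : (0 : ℝ) - 1 / ν = -(1 / ν) := by ring
      simpa [e] using this.ofReal_comp
    have h2 : HasDerivAt (fun y : ℝ => ((ν - y : ℝ) : ℂ)) (-1) x := by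
      simpa using ((hasDerivAt_id x).const_sub ν).ofReal_comp
    have hE : HasDerivAt (fun y : ℝ => cexp ((k : ℂ) * π * I * ((ν - y : ℝ) : ℂ)))
        (cexp ((k : ℂ) * π * I * ((ν - x : ℝ) : ℂ)) * ((k : ℂ) * π * I * (-1))) x :=
      (h2.const_mul ((k : ℂ) * π * I)).cexp
    have hd := h1.mul hE
    have heq : ∀ᶠ y in nhds x, kappaP ν k y
        = (((1 - y / ν : ℝ)) : ℂ) * cexp ((k : ℂ) * π * I * ((ν - y : ℝ) : ℂ)) := by
      filter_upwards [Iio_mem_nhds hxν] with y hy using kappaP_of_le (le_of_lt hy)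
    have hd' := (hd.congr_of_eventuallyEq heq).hasDerivWithinAt (s := Ioi x)
    rw [kappaP'_of_lt hxν]
    refine hd'.congr_deriv ?_
    have hν' : (ν : ℂ) ≠ 0 := by exact_mod_cast hν.ne'
    push_cast
    field_simp
    ring
  top := kappaP_self hν.ne'

/-- **The `δ = 1/20` instance on the manuscript's own piece:** if the off-diagonal form gives
`Re O(ϰ_{21/20,5/2}, ϰ_{21/20,5/2}) < 0.04311`, then E*-len(1/20) closes — by the kernel bracket
`−0.04313 < Re 𝔅♯(5/2, 21/20) < −0.04311` (`Repair.lengthKnifeEdge_witness`, p428360).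
[cite: Zhang2022LandauSiegel, Prop 7.1 p.44, (2.24) p.9] -/
theorem eStarLenCloses_of_kappa {O : PairFunctional}
    (h : (O (kappaP (21/20) (5/2)) (kappaP' (21/20) (5/2)) (kappaP (21/20) (5/2)) (kappaP' (21/20) (5/2))).re
      < 0.04311) : EStarLenCloses (1/20) O := by
  have e : (1 : ℝ) + 1/20 = 21/20 := by norm_num
  refine ⟨kappaP (21/20) (5/2), kappaP' (21/20) (5/2), ?_, ?_⟩
  · rw [e]; exact oneSidedProfile_kappaP (by norm_num)
  · rw [e, Complex.add_re, ← kappaDiagTop_eq_topDiagForm]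
    have := lengthKnifeEdge_witness.2
    linarith

end Kappa

end KnifeEdge

end Literature.NumberTheory.LFunctions.Zhang2022
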